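import Summits.ResolutionOfSingularities.ResolutionOfSingularities.Theorems.NearCutLengthMonotone
import Summits.ResolutionOfSingularities.ResolutionOfSingularities.Theorems.MaxContactCutNearCut
import Mathlib.Algebra.Order.BigOperators.Group.Finset
import HarnessLib

/-!
# NearCut §P6–§P7 (decomp-res lens-3 g23, PRIME SHEDDING part 3/3): wall lengths, the strict drop of the wall sum
# under contraction, the KERNEL THEOREM `chainShedding : ChainShedding`, and its consequences — `sheddingLemma`,
# `offWallShedding`, `noBalancedTails_of_nearChainPort : NearChainPort → NoBalancedTailsDeep` (ALL δ-balanced tails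
# modulo the ONE printed theorem CJS LNM 2270 Thm 5.40 (`B = ∅`) ALONE) and the EXACT re-location of the host aside
# 31770 `defectWalksDeep_iff_of_nearChainPort : NearChainPort → (MaxContactCut.DefectWalksDeep ↔
# NoFreePointTailsDeep ∧ NoHighPlanarJointTailsDeep ∧ NoLossyStrictTailsDeep)`

Pure additions in namespace `Summit.ResolutionOfSingularities.ResolutionOfSingularities.Theorems.NearCut`; content =
node HOME/decomp-res-lens-3/g23/NearCut.lean §P6–§P7
verbatim (farm-checked inside the node: rc 0, 0 sorry, `--axioms chainShedding / noBalancedTails_of_nearChainPort /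
defectWalksDeep_iff_of_nearChainPort` = propext, Classical.choice, Quot.sound).  Landing `chainShedding` closes the
ONE target item `ChainShedding` (--supports 31770) if the writer filed it; `BranchSelection` (NearCutArcs) is no longer
load-bearing (banked kernel `arc_shedding`, decoration).  See NODE-g23.md §2, §4.
-/

noncomputable section

open MvPolynomial Finset
open Literature.AlgebraicGeometry.Resolution
open Literature.AlgebraicGeometry.Resolution.Hauser2010
open Literature.AlgebraicGeometry.Resolution.PointBlowup
open Summit.ResolutionOfSingularities.ResolutionOfSingularities.Theses
open Summit.ResolutionOfSingularities.ResolutionOfSingularities.Theorems.TightDefectClasses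
open Summit.ResolutionOfSingularities.ResolutionOfSingularities.Theorems.TightDefectStrongWalks
open Summit.ResolutionOfSingularities.ResolutionOfSingularities.Theorems.ItineraryCutClasses
open Summit.ResolutionOfSingularities.ResolutionOfSingularities.Theorems.BoundaryLedger
open Summit.ResolutionOfSingularities.ResolutionOfSingularities.Theorems.ProximityCut
open Summit.ResolutionOfSingularities.ResolutionOfSingularities.Theorems.ConeCutAxisLaw
open Literature.AlgebraicGeometry.Resolution.WeightedBlowup
open Literature.Barriers.ResolutionOfSingularities
open Summit.ResolutionOfSingularities.ResolutionOfSingularities.Theorems.FloorCut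
open Summit.ResolutionOfSingularities.ResolutionOfSingularities.Theorems.ConeCut
open Summit.ResolutionOfSingularities.ResolutionOfSingularities.Theorems.ExitLaw (fin3_cases eq_of_le_of_degree_le)
open Summit.ResolutionOfSingularities.ResolutionOfSingularities.Theorems.ShadeCut
open Summit.ResolutionOfSingularities.ResolutionOfSingularities.Theorems.TightCut
open Summit.ResolutionOfSingularities.ResolutionOfSingularities.Theorems.HoleCut

namespace Summit.ResolutionOfSingularities.ResolutionOfSingularities.Theorems.NearCut

/-! ### §P6 Wall intersection lengths, the drop under contraction, and the proof of `ChainShedding` -/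

section Shedding

variable {K : Type} [Field K]

/-- The INTERSECTION LENGTH of the branch `P` with the wall `y_c = 0`: `ℓ_{R/P}((R/P)/(ȳ_c))`. -/
noncomputable def wallLen (P : Ideal (MvPolynomial (Fin 3) K)) (c : Fin 3) : ℕ∞ :=
  Module.length (MvPolynomial (Fin 3) K ⧸ P)
    ((MvPolynomial (Fin 3) K ⧸ P) ⧸ Ideal.span {Ideal.Quotient.mk P (X c)})

/-- `mk_X_ne_zero`: Auxiliary step of the lens-3 g23 §P prime-shedding calculus, VERBATIM from the lens file
tree/NearCutPrimeShedding.lean (see the module docstring); the statement is its type. [folklore] -/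
theorem mk_X_ne_zero {P : Ideal (MvPolynomial (Fin 3) K)} {c : Fin 3} (h : X c ∉ P) :
    Ideal.Quotient.mk P (X c) ≠ 0 := by
  rwa [Ne, Ideal.Quotient.eq_zero_iff_mem]

/-- Finite on one-dimensional branches not inside the wall (Krull–Akizuki). [folklore] -/
theorem wallLen_ne_top {P : Ideal (MvPolynomial (Fin 3) K)} [P.IsPrime]
    [Ring.KrullDimLE 1 (MvPolynomial (Fin 3) K ⧸ P)] {c : Fin 3} (h : X c ∉ P) : wallLen P c ≠ ⊤ :=
  length_quotient_span_singleton_ne_top (mk_X_ne_zero h)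

/-- Positive on branches through the closed point. [folklore] -/
theorem wallLen_pos {P : Ideal (MvPolynomial (Fin 3) K)} (hle : P ≤ idealOfVars (Fin 3) K) (c : Fin 3) :
    0 < wallLen P c := by
  rw [wallLen, Module.length_pos_iff, Ideal.Quotient.nontrivial_iff, Ne, Ideal.span_singleton_eq_top]
  intro hu
  have hker : ∀ f ∈ P, constantCoeff f = 0 := fun f hf => (mem_idealOfVars_iff_constantCoeff f).mp (hle hf)
  have := hu.map (Ideal.Quotient.lift P (constantCoeff : MvPolynomial (Fin 3) K →+* K) hker)
  rw [Ideal.Quotient.lift_mk, constantCoeff_X] at this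
  exact not_isUnit_zero this

/-- **The drop inequality.**  For a curve prime `P'` upstairs with `y_j, y_c ∉ P'` and a kept wall `c ≠ j`
(`b_c = 0`, so `σ y_c = y_j y_c`): `i(P', y_c) + i(P', y_j) ≤ i(σ⁻¹P', y_c)` — additivity of lengths in the
product `ȳ_j ȳ_c` and Krull–Akizuki monotonicity along `R/σ⁻¹P' ↪ R/P'`.  [new] [folklore] -/
theorem wallLen_add_le {j : Fin 3} {b : Fin 3 → K} (hb : b j = 0)
    {P' : Ideal (MvPolynomial (Fin 3) K)} [hP' : P'.IsPrime] (hXj : X j ∉ P') {c : Fin 3} (hcj : c ≠ j)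
    (hbc : b c = 0) (hXc : X c ∉ P')
    (hA : Ring.KrullDimLE 1 (MvPolynomial (Fin 3) K ⧸
      P'.comap (chartHom j b : MvPolynomial (Fin 3) K →+* MvPolynomial (Fin 3) K))) :
    wallLen P' c + wallLen P' j ≤
      wallLen (P'.comap (chartHom j b : MvPolynomial (Fin 3) K →+* MvPolynomial (Fin 3) K)) c := by
  set σ : MvPolynomial (Fin 3) K →+* MvPolynomial (Fin 3) K :=
    (chartHom j b : MvPolynomial (Fin 3) K →+* MvPolynomial (Fin 3) K) with hσ
  have hσapp : ∀ g, σ g = chartHom j b g := fun g => rfl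
  set P := P'.comap σ with hPdef
  haveI : P.IsPrime := Ideal.IsPrime.comap σ
  haveI := hA
  set f : MvPolynomial (Fin 3) K ⧸ P →+* MvPolynomial (Fin 3) K ⧸ P' := Ideal.quotientMap P' σ le_rfl with hf
  have hfmk : ∀ g, f (Ideal.Quotient.mk P g) = Ideal.Quotient.mk P' (σ g) := fun g => Ideal.quotientMap_mk
  have hfinj : Function.Injective f := Ideal.quotientMap_injective' le_rfl
  have ht : f (Ideal.Quotient.mk P (X j)) ≠ 0 := by
    rw [hfmk, hσapp, chartHom_X_self hb]
    exact mk_X_ne_zero hXj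
  have hden : ∀ x : MvPolynomial (Fin 3) K ⧸ P', ∃ (e : ℕ) (a : MvPolynomial (Fin 3) K ⧸ P),
      f (Ideal.Quotient.mk P (X j)) ^ e * x = f a := by
    intro x
    obtain ⟨g, rfl⟩ := Ideal.Quotient.mk_surjective x
    obtain ⟨e, g', hg'⟩ := exists_X_pow_mul_eq_chartHom hb g
    refine ⟨e, Ideal.Quotient.mk P g', ?_⟩
    rw [hfmk, hfmk, hσapp, hσapp, chartHom_X_self hb, ← map_pow, ← map_mul, hg']
  have ha : Ideal.Quotient.mk P (X c) ≠ 0 := mk_X_ne_zero (X_not_mem_comap_chartHom hb hXj hcj hbc hXc)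
  have hmono := length_quotient_map_le f hfinj ht hden ha
  have hfa : f (Ideal.Quotient.mk P (X c)) = Ideal.Quotient.mk P' (X j) * Ideal.Quotient.mk P' (X c) := by
    rw [hfmk, hσapp, chartHom_X_of_ne hb hcj, hbc, C_0, add_zero, map_mul]
  rw [hfa, ← Ideal.span_singleton_mul_span_singleton,
    length_quotient_span_singleton_mul_eq_add' _ (mk_X_ne_zero hXj)] at hmono
  exact hmono

/-- `toNat_add_toNat_le_toNat`: Auxiliary step of the lens-3 g23 §P prime-shedding calculus, VERBATIM from the lens
file tree/NearCutPrimeShedding.lean (see the module docstring); the statement is its type. [folklore] -/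
theorem toNat_add_toNat_le_toNat {x y z : ℕ∞} (h : x + y ≤ z) (hz : z ≠ ⊤) :
    x.toNat + y.toNat ≤ z.toNat := by
  lift z to ℕ using hz
  have hx : x ≠ ⊤ := by rintro rfl; simp at h
  have hy : y ≠ ⊤ := by rintro rfl; simp at h
  lift x to ℕ using hx
  lift y to ℕ using hy
  simp only [ENat.toNat_coe]
  exact_mod_cast h

/-- `one_le_toNat`: Auxiliary step of the lens-3 g23 §P prime-shedding calculus, VERBATIM from the lens file
tree/NearCutPrimeShedding.lean (see the module docstring); the statement is its type. [folklore] -/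
theorem one_le_toNat {x : ℕ∞} (h0 : 0 < x) (hx : x ≠ ⊤) : 1 ≤ x.toNat := by
  lift x to ℕ using hx
  rw [ENat.toNat_coe]
  exact Nat.one_le_iff_ne_zero.mpr (by rintro rfl; simp at h0)

/-- The elementary WALL-DROP count: if the new wall `j` carries `m ≥ 1`, every kept wall loses at least `m`, all
wall lengths are `≥ 1` and both levels have at least two walls, then the wall sum strictly drops. [folklore] -/
theorem sum_walls_lt (W W' : Finset (Fin 3)) (jn : Fin 3) (i i' : Fin 3 → ℕ) (m : ℕ) (hm : 1 ≤ m)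
    (hmj : i' jn = m) (hj : jn ∈ W') (hW : 1 < W.card) (hW' : 1 < W'.card)
    (hK : ∀ c ∈ W', c ≠ jn → c ∈ W ∧ i' c + m ≤ i c) (hpos : ∀ c ∈ W, 1 ≤ i c) :
    ∑ c ∈ W', i' c < ∑ c ∈ W, i c := by
  set Kp := W'.erase jn with hKp
  have hsplit : ∑ c ∈ W', i' c = m + ∑ c ∈ Kp, i' c := by
    rw [← hmj, ← Finset.add_sum_erase W' i' hj]
  have hKmem : ∀ c ∈ Kp, c ∈ W ∧ i' c + m ≤ i c :=
    fun c hc => hK c (Finset.mem_of_mem_erase hc) (Finset.ne_of_mem_erase hc)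
  have hKsub : Kp ⊆ W := fun c hc => (hKmem c hc).1
  have hKle : ∑ c ∈ Kp, i' c + m * Kp.card ≤ ∑ c ∈ Kp, i c := by
    rw [Finset.card_eq_sum_ones, Finset.mul_sum, ← Finset.sum_add_distrib]
    exact Finset.sum_le_sum fun c hc => by simpa using (hKmem c hc).2
  have hKW : ∑ c ∈ Kp, i c ≤ ∑ c ∈ W, i c := Finset.sum_le_sum_of_subset hKsub
  have hKcard : Kp.card + 1 = W'.card := by
    rw [hKp, Finset.card_erase_of_mem hj]; omega
  by_cases h2 : 2 ≤ Kp.card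
  · have : m * 2 ≤ m * Kp.card := Nat.mul_le_mul_left m h2
    omega
  · have hK1 : Kp.card = 1 := by omega
    obtain ⟨k, hk⟩ := Finset.card_eq_one.mp hK1
    have hkW : k ∈ W := hKsub (hk ▸ Finset.mem_singleton_self k)
    obtain ⟨c₂, hc₂W, hc₂k⟩ := Finset.exists_mem_ne hW k
    have hpair : i k + i c₂ ≤ ∑ c ∈ W, i c := by
      rw [← Finset.sum_pair hc₂k.symm]
      refine Finset.sum_le_sum_of_subset ?_
      intro c hc
      simp only [Finset.mem_insert, Finset.mem_singleton] at hc
      rcases hc with rfl | rfl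
      · exact hkW
      · exact hc₂W
    have hKsum : ∑ c ∈ Kp, i c = i k := by rw [hk, Finset.sum_singleton]
    have hKsum' : ∑ c ∈ Kp, i' c = i' k := by rw [hk, Finset.sum_singleton]
    have := hpos c₂ hc₂W
    have := (hKmem k (hk ▸ Finset.mem_singleton_self k)).2
    omega

/-- **PRIME SHEDDING — the kernel proof of `ChainShedding`** (g22 §N5c's residual; hence of `BranchSelection`'s
every use, `SheddingLemma`, `OffWallShedding`, and — modulo the ONE printed port `NearChainPort` — of the located
residual `NoBalancedTailsDeep`).  Along an infinite formal chain of closed-point blowups with constant order `s`,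
NEAR certificates at `≥ 2` walls at every level, the new wall always recorded and kept walls untranslated, the
multiplicity is eventually ISOLATED.  Proof: curve primes contract down the chain (`comap_mem_curvePrimes`); the wall
potential `Σ_{walls} ℓ((R/P)/ȳ_c) ∈ ℕ` strictly drops under contraction (`wallLen_add_le` + `sum_walls_lt`); so a
level-`0` curve prime of arbitrarily large potential would exist, contradicting the finiteness of the set of curve
primes (`curvePrimes_finite`).  [new] [folklore] -/
theorem chainShedding : ChainShedding := by
  intro K _ s _ G j b wall hb hrec hord htwo hexc hkept hcert
  classical
  -- the chart homomorphisms of the chain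
  have hσG : ∀ n, chartHom (j n) (b n) (G n) = X (j n) ^ s * G (n + 1) := fun n => by
    rw [hrec n]; exact chartHom_apply_eq (hb n) (G n) (le_of_eq (hord n).symm)
  -- curve primes: walls stay out, quotients are one-dimensional, contraction works
  have hX : ∀ n P, P ∈ curvePrimes s (G n) → ∀ c, wall n c → X c ∉ P :=
    fun n P hP c hc => X_not_mem_of_mem_curvePrimes hP (hcert n c hc)
  have hdim : ∀ n P, P ∈ curvePrimes s (G n) → Ring.KrullDimLE 1 (MvPolynomial (Fin 3) K ⧸ P) := by
    intro n P hP
    obtain ⟨c₁, c₂, -, hc₁, -⟩ := htwo n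
    exact krullDimLE_one_of_mem_curvePrimes hP (hcert n c₁ hc₁)
  have hcomap : ∀ n P', P' ∈ curvePrimes s (G (n + 1)) →
      P'.comap (chartHom (j n) (b n) : MvPolynomial (Fin 3) K →+* MvPolynomial (Fin 3) K) ∈
        curvePrimes s (G n) :=
    fun n P' hP' => comap_mem_curvePrimes (hb n) (hσG n) hP' (hX (n + 1) P' hP' (j n) (hexc n))
  -- if shedding failed, every level would carry a curve prime
  by_contra hcon
  push Not at hcon
  have hne : ∀ n, (curvePrimes s (G n)).Nonempty := by
    have down : ∀ d n, (curvePrimes s (G (n + d))).Nonempty → (curvePrimes s (G n)).Nonempty := by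
      intro d
      induction d with
      | zero => intro n h; simpa using h
      | succ d ih =>
        intro n h
        obtain ⟨P', hP'⟩ := h
        exact ih n ⟨_, hcomap (n + d) P' hP'⟩
    intro n
    obtain ⟨n', hn', hni⟩ := hcon n
    obtain ⟨d, rfl⟩ := Nat.exists_eq_add_of_le hn'
    exact down d n (curvePrimes_nonempty_of_not_isolatedMult hni)
  -- the walls and the potential
  set W : ℕ → Finset (Fin 3) := fun n => Finset.univ.filter fun c => wall n c with hW
  have hWmem : ∀ n c, c ∈ W n ↔ wall n c := fun n c => by simp [hW]
  have hWcard : ∀ n, 1 < (W n).card := fun n => by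
    obtain ⟨c₁, c₂, hne', hc₁, hc₂⟩ := htwo n
    exact Finset.one_lt_card.mpr ⟨c₁, (hWmem n c₁).mpr hc₁, c₂, (hWmem n c₂).mpr hc₂, hne'⟩
  set Φ : ℕ → Ideal (MvPolynomial (Fin 3) K) → ℕ := fun n P => ∑ c ∈ W n, (wallLen P c).toNat with hΦ
  have hfinlen : ∀ n P, P ∈ curvePrimes s (G n) → ∀ c, wall n c → wallLen P c ≠ ⊤ := by
    intro n P hP c hc
    haveI := hP.1
    haveI := hdim n P hP
    exact wallLen_ne_top (hX n P hP c hc)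
  have hposlen : ∀ n P, P ∈ curvePrimes s (G n) → ∀ c, wall n c → 1 ≤ (wallLen P c).toNat :=
    fun n P hP c hc => one_le_toNat (wallLen_pos hP.2.2.1 c) (hfinlen n P hP c hc)
  -- THE DROP of the potential under contraction
  have hdrop : ∀ n P', P' ∈ curvePrimes s (G (n + 1)) →
      Φ (n + 1) P' <
        Φ n (P'.comap (chartHom (j n) (b n) : MvPolynomial (Fin 3) K →+* MvPolynomial (Fin 3) K)) := by
    intro n P' hP'
    set P := P'.comap (chartHom (j n) (b n) : MvPolynomial (Fin 3) K →+* MvPolynomial (Fin 3) K) with hPdef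
    have hP : P ∈ curvePrimes s (G n) := hcomap n P' hP'
    haveI := hP'.1
    have hXj : X (j n) ∉ P' := hX (n + 1) P' hP' (j n) (hexc n)
    refine sum_walls_lt (W n) (W (n + 1)) (j n) (fun c => (wallLen P c).toNat) (fun c => (wallLen P' c).toNat)
      ((wallLen P' (j n)).toNat) (hposlen (n + 1) P' hP' (j n) (hexc n)) rfl ((hWmem _ _).mpr (hexc n))
      (hWcard n) (hWcard (n + 1)) (fun c hc hcj => ?_) (fun c hc => hposlen n P hP c ((hWmem n c).mp hc))
    obtain ⟨hwc, hbc⟩ := hkept n c ((hWmem _ _).mp hc) hcj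
    refine ⟨(hWmem n c).mpr hwc, ?_⟩
    have hXc : X c ∉ P' := hX (n + 1) P' hP' c ((hWmem _ _).mp hc)
    have hstep := wallLen_add_le (hb n) hXj hcj hbc hXc (hdim n P hP)
    exact toNat_add_toNat_le_toNat hstep (hfinlen n P hP c hwc)
  -- unbounded potentials at every level ...
  have hunb : ∀ k n, ∃ P ∈ curvePrimes s (G n), k ≤ Φ n P := by
    intro k
    induction k with
    | zero =>
      intro n
      obtain ⟨P, hP⟩ := hne n
      exact ⟨P, hP, Nat.zero_le _⟩
    | succ k ih =>
      intro n
      obtain ⟨P', hP', hk⟩ := ih (n + 1)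
      exact ⟨_, hcomap n P' hP', by have := hdrop n P' hP'; omega⟩
  -- ... but bounded at level 0: contradiction
  have hfin : (curvePrimes s (G 0)).Finite := curvePrimes_finite (hdim 0)
  obtain ⟨B, hB⟩ := (hfin.image (Φ 0)).bddAbove
  obtain ⟨P, hP, hk⟩ := hunb (B + 1) 0
  have := hB (Set.mem_image_of_mem (Φ 0) hP)
  omega

end Shedding

end Summit.ResolutionOfSingularities.ResolutionOfSingularities.Theorems.NearCut

namespace Summit.ResolutionOfSingularities.ResolutionOfSingularities.Theorems.NearCut

open Summit.ResolutionOfSingularities.ResolutionOfSingularities.Theorems.FreezeCut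
open Summit.ResolutionOfSingularities.ResolutionOfSingularities.Theorems.WallCut

/-! ### §P7 CONSEQUENCES — the named pieces of g22 are theorems; the balanced family and the exact re-location of
31770 hold modulo the ONE EQUIV `NearChainPort` ALONE -/

section Consequences

/-- The SHEDDING LEMMA (g22 §N2's named target) is a theorem. [folklore] -/
theorem sheddingLemma : SheddingLemma := sheddingLemma_of_chainShedding chainShedding

/-- OFF-WALL SHEDDING (g22 §N5's named target) is a theorem. [folklore] -/
theorem offWallShedding : OffWallShedding := offWallShedding_of_chainShedding chainShedding

/-- **ALL δ-balanced tails are excluded modulo the ONE printed theorem** (CJS LNM 2270 Thm 5.40, `B = ∅`). [folklore] -/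
theorem noBalancedTails_of_nearChainPort (hP : NearChainPort) : NoBalancedTailsDeep :=
  noBalancedTails_of_port_chain hP chainShedding

/-- The wild balanced strict class (critic (a″), `p ∣ s`) modulo the port alone. [folklore] -/
theorem noWildBalancedStrictTails_of_nearChainPort (hP : NearChainPort) : NoWildBalancedStrictTailsDeep :=
  noWildBalancedStrictTails_of_noBalancedTails (noBalancedTails_of_nearChainPort hP)

/-- The tame balanced strict class (g21's port class, Tschirnhaus-free) modulo the port alone. [folklore] -/
theorem noTameBalancedStrictTails_of_nearChainPort (hP : NearChainPort) : NoTameBalancedStrictTailsDeep :=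
  noTameBalancedStrictTails_of_noBalancedTails (noBalancedTails_of_nearChainPort hP)

/-- The balanced boundary class (g20's port class) modulo the port alone. [folklore] -/
theorem noBalancedBoundaryTails_of_nearChainPort (hP : NearChainPort) : NoBalancedBoundaryTailsDeep :=
  noBalancedBoundaryTails_of_noBalancedTails (noBalancedTails_of_nearChainPort hP)

/-- **EXACT RE-LOCATION OF THE HOST ASIDE 31770 MODULO THE ONE EQUIV ALONE**: given CJS Thm 5.40 (`B = ∅`) for near
point-blowup chains of isolated-multiplicity surface germs, `DefectWalksDeep` is EQUIVALENT to the conjunction of the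
three located, pairwise foreign residual classes — free-point tails, high-planar joint tails, lossy strict tails. [folklore] -/
theorem defectWalksDeep_iff_of_nearChainPort (hP : NearChainPort) :
    MaxContactCut.DefectWalksDeep ↔
      NoFreePointTailsDeep ∧ NoHighPlanarJointTailsDeep ∧ NoLossyStrictTailsDeep :=
  defectWalksDeep_iff_of_nearPort_chain hP chainShedding

end Consequences

end Summit.ResolutionOfSingularities.ResolutionOfSingularities.Theorems.NearCut
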